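import Mathlib
import Literature.Analysis.FluidPDE.Tao2016AveragedNS.RestartedCascadeFlows
import HarnessLib

/-!
# `HeteroclinicTriggerChain` — crux `TriggerChainFrontStep` (item stmt-NavierStokesRegularity-22785):
  a robust front step cannot be anchored at an equilibrium — the datum must be SEEDED

A NECESSARY CONDITION on every witness of the crux's conclusion (helper, no stub credit). The (step)
clause `RobustStep ε₀ θ c η i₀ α P env` quantifies over EVERY `(η,η)`-pseudo-flow from every `P`-state; if
`P` holds at a summable EQUILIBRIUM state `S₀` of the table (with energies `½S₀²`) whose receiver
`S₀ i₀ 1` vanishes, then the CONSTANT flow `S ≡ S₀`, `F ≡ ½S₀²` is an admissible pseudo-flow on every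
horizon (zero slack, `L = 0` past epochs) and it never charges the receiver, so no checkpoint step
`StepTo` (which needs `0 < a ≤ |S i₀ 1 τ₁|`) exists: `RobustStep` fails (`robustStep_false_of_equilibrium`).
Under the (purity) clause of the trigger chain (pure-`i₀` families are zeros of `quadTerm`), every PURE
one-shell datum is such an equilibrium (`robustStep_false_of_pure_datum`); consequently any witness
`(β, θ, c, η, j₀, X₀, P, env)` of the conclusion of `TriggerChainFrontStep` for the pinned table
`α₀ + βσ` has a datum `X₀` charging some mode other than the carrier `i₀`
(`triggerChainFrontStep_witness_datum_seeded`) — the seed must sit in the datum, as the card intends.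

HONEST FRAMING: elementary facts about the MODEL-lattice predicates `PseudoFlowOn` / `RobustStep`
(Tao 2016 §4/§6 vocabulary); nothing here is a statement about the Navier–Stokes equations; no summit,
rung or crux is proved or refuted by this file.
-/

noncomputable section

set_option linter.dupNamespace false

open Set MeasureTheory intervalIntegral

namespace Summit.NavierStokesRegularity.NavierStokesRegularity.Theorems

open Literature.Analysis.FluidPDE Literature.Analysis.FluidPDE.TaoCascade

/-- With no past epochs the canonical slack envelope vanishes. [folklore] -/
theorem htcSD_slackWeight_zero (ε₀ θ c : ℝ) (env : ℤ → ℝ) (k : ℤ) :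
    slackWeight ε₀ θ c env 0 k = 0 := by
  simp [slackWeight]

/-- **The constant flow at a summable equilibrium is an `(η,η)`-pseudo-flow** on every horizon, with
zero accumulated slack and energies `½S₀²`. [folklore] -/
theorem htcSD_pseudoFlowOn_const {τ ε₀ η : ℝ} {m : ℕ}
    {α : Fin m → Fin m → Fin m → ℤ × ℤ × ℤ → ℝ} {S₀ : Fin m → ℤ → ℝ}
    (hε : 0 ≤ 1 + ε₀) (hη : 0 ≤ η)
    (hbound : ∃ M : ℝ, ∀ (i : Fin m) (k : ℤ), (1 + (1 + ε₀) ^ ((10 : ℝ) * k)) * |S₀ i k| ≤ M)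
    (hequil : ∀ (i : Fin m) (k : ℤ), quadTerm ε₀ α (fun j n (_ : ℝ) => S₀ j n) i k 0 = 0) :
    PseudoFlowOn τ ε₀ α η η S₀ (fun i k => (1 / 2) * S₀ i k ^ 2) (fun _ _ => 0)
      (fun i k _ => S₀ i k) (fun i k _ => (1 / 2) * S₀ i k ^ 2) where
  contDiffOn_S _ _ := contDiffOn_const
  contDiffOn_F _ _ := contDiffOn_const
  nonneg_F i k s _ := by positivity
  apriori_S := by
    obtain ⟨M, hM⟩ := hbound
    exact ⟨M, fun s _ i k => hM i k⟩
  apriori_F := by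
    obtain ⟨M, hM⟩ := hbound
    refine ⟨M, fun s _ i k => le_trans ?_ (hM i k)⟩
    have hw : 0 ≤ 1 + (1 + ε₀) ^ ((10 : ℝ) * k) := by positivity
    refine mul_le_mul_of_nonneg_left ?_ hw
    calc Real.sqrt ((1 / 2 : ℝ) * S₀ i k ^ 2) ≤ Real.sqrt (S₀ i k ^ 2) :=
          Real.sqrt_le_sqrt (by nlinarith [sq_nonneg (S₀ i k)])
      _ = |S₀ i k| := Real.sqrt_sq_eq_abs _
  init_S _ _ := rfl
  init_F _ _ := rfl
  motion i k s _ := by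
    have hq : quadTerm ε₀ α (fun j n (_ : ℝ) => S₀ j n) i k s = 0 := hequil i k
    rw [derivWithin_fun_const, Pi.zero_apply, hq, sub_zero, abs_zero]
    positivity
  energy i k s _ := by
    have hq : quadTerm ε₀ α (fun j n (_ : ℝ) => S₀ j n) i k s = 0 := hequil i k
    rw [derivWithin_fun_const, Pi.zero_apply, hq, zero_mul]
  defect_lower _ _ _ _ := le_rfl
  defect_upper i k s hs := by
    rw [intervalIntegral.integral_const, add_zero, smul_eq_mul, sub_zero]
    have h1 : 0 ≤ η * (1 + ε₀) ^ ((2 : ℝ) * k) * (s * ((1 / 2) * S₀ i k ^ 2)) := by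
      have := hs.1
      positivity
    linarith

/-- **An equilibrium in `P` with a silent receiver defeats the (step) clause.** If `η ≥ 0`,
`1 + ε₀ ≥ 0` (any clock `c`) and `P` holds at a summable equilibrium state `S₀` (energies `½S₀²`) with `S₀ i₀ 1 = 0`, then
`RobustStep ε₀ θ c η i₀ α P env` is false: the constant pseudo-flow admits no `StepTo`. [folklore] -/
theorem robustStep_false_of_equilibrium {ε₀ θ c η : ℝ} {m : ℕ} {i₀ : Fin m}
    {α : Fin m → Fin m → Fin m → ℤ × ℤ × ℤ → ℝ}
    {P : (Fin m → ℤ → ℝ) → (Fin m → ℤ → ℝ) → Prop} {env : ℤ → ℝ} {S₀ : Fin m → ℤ → ℝ}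
    (hε : 0 ≤ 1 + ε₀) (hη : 0 ≤ η)
    (hbound : ∃ M : ℝ, ∀ (i : Fin m) (k : ℤ), (1 + (1 + ε₀) ^ ((10 : ℝ) * k)) * |S₀ i k| ≤ M)
    (hequil : ∀ (i : Fin m) (k : ℤ), quadTerm ε₀ α (fun j n (_ : ℝ) => S₀ j n) i k 0 = 0)
    (hrecv : S₀ i₀ 1 = 0) (hP : P S₀ (fun i k => (1 / 2) * S₀ i k ^ 2)) :
    ¬ RobustStep ε₀ θ c η i₀ α P env := by
  intro hR
  have hslack : ∀ (i : Fin m) (k : ℤ), (0 : ℝ) ≤ (fun _ _ => (0 : ℝ)) i k ∧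
      (fun _ _ => (0 : ℝ)) i k ≤ η * slackWeight ε₀ θ c env 0 k := by
    intro i k
    simp [htcSD_slackWeight_zero]
  obtain ⟨τ₁, a, -, -, ha, -, hamp, -⟩ :=
    hR 0 S₀ _ _ hP hslack c le_rfl _ _ (htcSD_pseudoFlowOn_const (τ := c) hε hη hbound hequil)
  have : |S₀ i₀ 1| = 0 := by rw [hrecv, abs_zero]
  linarith [hamp.trans_eq this]

/-- `quadTerm` is linear in the table: the pinned table `α₀ + βσ` drives `quadTerm α₀ + β·quadTerm σ`.
[folklore] -/
theorem htcSD_quadTerm_add_smul (ε₀ β : ℝ) {m : ℕ} (α₀ σ : Fin m → Fin m → Fin m → ℤ × ℤ × ℤ → ℝ)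
    (X : Fin m → ℤ → ℝ → ℝ) (i : Fin m) (n : ℤ) (t : ℝ) :
    quadTerm ε₀ (fun j₁ j₂ j₃ μ => α₀ j₁ j₂ j₃ μ + β * σ j₁ j₂ j₃ μ) X i n t =
      quadTerm ε₀ α₀ X i n t + β * quadTerm ε₀ σ X i n t := by
  simp only [quadTerm, Finset.mul_sum, ← Finset.sum_add_distrib]
  refine Finset.sum_congr rfl fun i₁ _ => Finset.sum_congr rfl fun i₂ _ =>
    Finset.sum_congr rfl fun μ _ => ?_
  ring

/-- The rescaled datum energies are half the squares of the rescaled datum state. [folklore] -/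
theorem htcSD_datumEnergy_eq {m : ℕ} (j₀ : Fin m) (X₀ : Fin m → ℝ) :
    datumEnergy j₀ X₀ = fun i k => (1 / 2) * datumState j₀ X₀ i k ^ 2 := by
  funext i k
  rw [datumEnergy_apply, datumState_apply]
  split_ifs
  · rw [div_pow]
    ring
  · simp

/-- **A PURE one-shell datum defeats the (step) clause.** If pure-`i₀` families are zeros of
`quadTerm ε₀ α` (purity), `1 + ε₀ ≥ 0`, `η ≥ 0`, the one-shell datum `X₀` charges only the carrier `i₀`,
and `P` holds at the rescaled datum, then `RobustStep ε₀ θ c η j₀ α P env` is false (whatever the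
observable mode `j₀`, clock `c`, exponent `θ` and envelope `env`). [folklore] -/
theorem robustStep_false_of_pure_datum {ε₀ θ c η : ℝ} {m : ℕ} {i₀ j₀ : Fin m}
    {α : Fin m → Fin m → Fin m → ℤ × ℤ × ℤ → ℝ}
    {P : (Fin m → ℤ → ℝ) → (Fin m → ℤ → ℝ) → Prop} {env : ℤ → ℝ} {X₀ : Fin m → ℝ}
    (hε : 0 ≤ 1 + ε₀) (hη : 0 ≤ η)
    (hpure : ∀ X : Fin m → ℤ → ℝ → ℝ, (∀ i n t, i ≠ i₀ → X i n t = 0) →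
      ∀ i n t, quadTerm ε₀ α X i n t = 0)
    (hX : ∀ i, i ≠ i₀ → X₀ i = 0) (hP : P (datumState j₀ X₀) (datumEnergy j₀ X₀)) :
    ¬ RobustStep ε₀ θ c η j₀ α P env := by
  rw [htcSD_datumEnergy_eq] at hP
  refine robustStep_false_of_equilibrium hε hη ?_ ?_ (datumState_of_ne j₀ X₀ j₀ one_ne_zero) hP
  · refine ⟨2 * ∑ j, |datumState j₀ X₀ j 0|, fun i k => ?_⟩
    have hsum : |datumState j₀ X₀ i 0| ≤ ∑ j, |datumState j₀ X₀ j 0| :=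
      Finset.single_le_sum (f := fun j => |datumState j₀ X₀ j 0|) (fun j _ => abs_nonneg _)
        (Finset.mem_univ i)
    by_cases hk : k = 0
    · subst hk
      simp only [Int.cast_zero, mul_zero, Real.rpow_zero]
      linarith
    · rw [datumState_of_ne j₀ X₀ i hk, abs_zero, mul_zero]
      positivity
  · intro i k
    exact hpure _ (fun j n _ hj => by simp [datumState_apply, hX j hj]) i k 0

/-- **Item stmt-NavierStokesRegularity-22785 (`TriggerChainFrontStep`), a necessary condition on every
witness of its conclusion: THE DATUM IS SEEDED.** Under the (purity) clause of the unseeded trigger chain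
for `(α₀, σ)` with carrier `i₀`, if `P` holds at the rescaled one-shell datum `X₀` and the (step) clause
`RobustStep 1 θ c η j₀ (α₀ + βσ) P env` holds with margin `η > 0`, then `X₀` charges some mode other than
the carrier. (So in the crux's conclusion `X₀ ≠ X₀ i₀ · δ_{i₀}`: the trigger seed sits in the datum.)
[folklore] -/
theorem triggerChainFrontStep_witness_datum_seeded
    (α₀ σ : Fin 4 → Fin 4 → Fin 4 → ℤ × ℤ × ℤ → ℝ) (i₀ : Fin 4)
    (hpure : ∀ X : Fin 4 → ℤ → ℝ → ℝ, (∀ i n t, i ≠ i₀ → X i n t = 0) → ∀ i n t,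
      quadTerm 1 α₀ X i n t = 0 ∧ quadTerm 1 σ X i n t = 0)
    {β θ c η : ℝ} {j₀ : Fin 4} {X₀ : Fin 4 → ℝ}
    {P : (Fin 4 → ℤ → ℝ) → (Fin 4 → ℤ → ℝ) → Prop} {env : ℤ → ℝ} (hη : 0 < η)
    (hP : P (datumState j₀ X₀) (datumEnergy j₀ X₀))
    (hstep : RobustStep 1 θ c η j₀ (fun j₁ j₂ j₃ μ => α₀ j₁ j₂ j₃ μ + β * σ j₁ j₂ j₃ μ) P env) :
    ∃ i : Fin 4, i ≠ i₀ ∧ X₀ i ≠ 0 := by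
  by_contra h
  simp only [not_exists, not_and, not_not] at h
  refine robustStep_false_of_pure_datum (by norm_num) hη.le (fun X hX i n t => ?_) h hP hstep
  rw [htcSD_quadTerm_add_smul, (hpure X hX i n t).1, (hpure X hX i n t).2, mul_zero, add_zero]

end Summit.NavierStokesRegularity.NavierStokesRegularity.Theorems

end
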